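import Mathlib.Analysis.Calculus.BumpFunction.Basic
import Mathlib.Analysis.Calculus.BumpFunction.InnerProduct
import Literature.Barriers.AtomisticToContinuum.ShockFormationProofs
import HarnessLib

/-!
# Narrowed barrier `ShockFormationBarrierNarrow` (barrier audit of `ShockFormation`, 2026-08-15)

`Literature/Barriers/AtomisticToContinuum/` (D-0021 barrier catalogue), sub-problem
`HydrodynamicLimit`. Companion of `ShockFormation.lean` (`ShockFormationBarrier` = Sideris 1985,
Thm 1: `C¹` polytropic Euler flows on `ℝ³` with data (1.2), (1.5 a–c) have finite life span —
proved in the tree, `ShockFormationBarrier_holds`, files `ShockFormation{Pointwise, Identities,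
Propagation, Energy, EnergyIdentity, Estimates, Proofs}`), whose BARRIER block reads the printed
restriction of Yau's relative entropy method ("up to the appearance of the first shock") as
blocking the technique class `relative-entropy entropy-method weak-strong-uniqueness
relative-energy` beyond the classical existence time.

**Audit (refuter, 2026-08-15).** (i) Kernel: the Prop is Sideris' Theorem 1 verbatim — (1.5 a–c)
p. 477, `α = 16π/3` p. 480 of the held copy — and is a theorem of the tree (axioms `propext`,
`Classical.choice`, `Quot.sound`); its hypothesis class is inhabited by SMOOTH data (clause (2)
below: Sideris' own example `ρ⁰ ≡ ρ̄`, `S⁰ ≡ S̄`, "(1.5c) holds if `∫ x·u⁰ dx > ασR⁴`", p. 477,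
realised with a bump), and the solution predicate `IsPolytropicC1Solution … (Ici 0)` is inhabited
by a non-trivial GLOBAL flow (clause (3): the homologous expansion `u = x/(1+t)`,
`ρ = ρ̄(1+t)⁻³`, `S = S̄`), so "finite life span" is a property of the data class, not of the
system. The parent quotations of Kipnis–Landim (Ch. 6 p. 116, Remark 1.13) and
Olla–Varadhan–Yau (§1 p. 525) were re-read and are verbatim. (ii) Technique class: TOO BROAD. The
printed sources restrict only the CLASSICAL sub-family — relative entropy (or energy) taken with
respect to the local Gibbs state / Maxwellian / state vector of an UNSHIFTED Lipschitz solution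
(Yau 1991, Olla–Varadhan–Yau 1993, Kipnis–Landim Ch. 6; Dafermos–DiPerna weak–strong uniqueness;
Březina–Feireisl). As of 2011 this was indeed the frontier: "Up to now, this method works as long
as the limit solution is Lipschitz. It would be of significant interest to extend the method to
shocks" (Leger–Vasseur 2011, §1). Since then the WEIGHTED relative entropy UP TO A DYNAMICAL SHIFT
(the a-contraction theory of Kang–Vasseur) passes entropy shocks in one space dimension: `L²`
stability and uniqueness of extremal shocks among bounded entropy solutions with strong traces
(Leger–Vasseur 2011), weak–`BV` uniqueness for `2 × 2` systems (Chen–Krupa–Vasseur 2022),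
uniqueness of entropy shocks of isentropic Euler among ALL vanishing-viscosity limits of
Navier–Stokes, "measured by a weighted relative entropy" (Kang–Vasseur, Invent. Math. 2020/21,
Thm 1.1), and — May 2026 preprint — the hydrodynamic limit of the one-dimensional HARD-SPHERE
BOLTZMANN equation toward generic Riemann solutions WITH SHOCKS, "a kinetic adaptation of the
a-contraction method", `L²([0,T] × ℝ × ℝ³)` convergence for every `T` (Choe–Kang–Kim,
arXiv:2605.24392, Thm 1.1): "the a-contraction method combines the relative entropy method with
suitable weight and shift ... the relative entropy method alone is sufficient to establish the
stability of regular solutions other than shocks" (ibid. §1 p. 5). Earlier, non-relative-entropy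
kinetic → Euler limits across shocks: Yu 2005, Huang–Wang–Wang–Yang 2013 (Riemann superpositions,
energy method around Boltzmann shock profiles). (iii) Scope: finite-time breakdown for a GENERAL
smooth non-Chaplygin equation of state `p = p(ρ, s)` (so formally the conjunct's hard-sphere law)
near plane-symmetric simple waves on `ℝ × 𝕋²` is in print (Luk–Speck 2024), sharpening the
parent's caveat (a); conversely on `𝕋` (planar data on `𝕋³`) the `3 × 3` system with a generic
non-constant entropy profile carries smooth space- and time-periodic shock-free "pure tones"
(Temple–Young 2023, Thms 1.3–1.4, Cor. 1.6; general constitutive law `v = v(p, s)`, `v_p < 0`), so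
a first shock need not occur at all. In three dimensions without planar symmetry the operative
post-shock obstruction is not the method but the target: admissible weak solutions are non-unique
(`WildSolutionsBarrier`). Verdict: NARROWED — entry `ShockFormationBarrierNarrow` below, typed
and proved (`shockFormationBarrierNarrow_holds`).

Contents: the homologous expansion (`PolytropicEuler.expandDensity/Velocity/Entropy`,
`PolytropicEuler.expandingFlow_isSolution`); smooth Sideris data (`PolytropicEuler.dataBump`,
`PolytropicEuler.outgoingVelocity`, `PolytropicEuler.exists_smooth_siderisLargeData`); the entry
and its discharge.

## References

* [Sideris1985] T. C. Sideris, Comm. Math. Phys. 101 (1985) 475–485: Thm 1 p. 477, (1.5 a–c),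
  the example after Thm 1, §2 p. 480 (`α = 16π/3`).
* [KipnisLandim1999] Ch. 6 pp. 115–116, Remark 1.13; Ch. 8. [OllaVaradhanYau1993] §1 p. 525, Thm 2.1.
* [LegerVasseur2011] N. Leger, A. Vasseur, ARMA 201 (2011) 271–302 (arXiv:1008.3113): Abstract,
  §1 pp. 2 and 4.
* [KangVasseur2020] M.-J. Kang, A. F. Vasseur, Invent. Math. 224 (2021) 55–146 (arXiv:1902.01792):
  Abstract, §1 p. 3, Thm 1.1, Remark 1.1 (2).
* [ChenKrupaVasseur2022] ARMA 246 (2022) 299–332 (arXiv:2010.04761): Abstract, Thms 1.3–1.4.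
* [ChoeKangKim2026] M. Choe, M.-J. Kang, C. Kim, arXiv:2605.24392 (May 2026, preprint): Abstract,
  §1 pp. 4–6, Thm 1.1 (informal of Thms 2.1, 9.1).
* [HuangEtAl2013] F. Huang, Y. Wang, Y. Wang, T. Yang, SIAM J. Math. Anal. 45 (2013) 1741–1811
  (arXiv:1109.6751): Abstract, §1 (incl. the report on S.-H. Yu, CPAM 58 (2005)).
* [LukSpeck2024] J. Luk, J. Speck, Anal. PDE 17 (2024) 831–941 (arXiv:2107.03426): Abstract, §1.
* [TempleYoung2023] B. Temple, R. Young, arXiv:2305.15623 (preprint): Abstract, (1.2)–(1.8),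
  Thms 1.3–1.4, Cor. 1.6.
* [Markfelder2021] LNM 2294, Thm 8.2.1 (via `WildSolutions.lean`). [Dafermos2005] §7.7 Thm 7.7.2,
  §7.9 Notes ("For global classical solutions to the Euler equations, see Serre [11] and Grassin
  and Serre [1]").
* [Fritz2004] pp. 143–145; [FritzToth2004]; [Rezakhanlou1991]; [BrezinaFeireisl2018] Thm 3.3.
-/

noncomputable section

open Set MeasureTheory Metric
open Literature.Analysis.FluidPDE Literature.Analysis.FluidPDE.VectorCalculus
open scoped RealInnerProductSpace ContDiff

namespace Literature.Barriers.AtomisticToContinuum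

namespace PolytropicEuler

/-! ### Clause (3): a non-trivial global `C¹` flow (homologous expansion) -/

/-- Density `ρ(t, x) = ρ̄ (1+t)⁻³` of the homologous expansion. [folklore] -/
def expandDensity (ρbar : ℝ) (t : ℝ) (_x : E3) : ℝ :=
  ρbar * ((1 + t) ^ 3)⁻¹

/-- Velocity `u(t, x) = x/(1+t)` of the homologous expansion. [folklore] -/
def expandVelocity (t : ℝ) (x : E3) : E3 :=
  (1 + t)⁻¹ • x

/-- Entropy `S(t, x) = S̄` of the homologous expansion. [folklore] -/
def expandEntropy (Sbar : ℝ) (_t : ℝ) (_x : E3) : ℝ :=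
  Sbar

/-- `div (c x) = 3c` on `ℝ³` (trace of `c · id`). [folklore] -/
theorem divergence_const_smul_id (c : ℝ) (x : E3) :
    divergence (fun y : E3 => c • y) x = 3 * c := by
  have h : (fun y : E3 => c • y) = ⇑(c • ContinuousLinearMap.id ℝ E3) := by
    funext y; simp
  rw [divergence, h, ContinuousLinearMap.fderiv]
  simp [LinearMap.trace_id, mul_comm]

/-- At `t = 0` the expansion velocity is the identity field `u₀(x) = x` (not a rest state).
[folklore] -/
theorem expandVelocity_zero : expandVelocity 0 = id := by
  funext x
  simp [expandVelocity]

/-- **The homologous expansion is a global `C¹` solution.** For every `A, γ` and `ρ̄ > 0`, `S̄`,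
the fields `ρ = ρ̄(1+t)⁻³`, `u = x/(1+t)`, `S = S̄` satisfy `IsPolytropicC1Solution A γ (Ici 0)`:
`∂ₜu + (u·∇)u = -x/(1+t)² + x/(1+t)² = 0` and the pressure is spatially constant, so (1.1b) holds
for ANY equation of state; `∂ₜρ + div(ρu) = -3ρ̄(1+t)⁻⁴ + 3ρ̄(1+t)⁻⁴ = 0`; `S` is constant.
(Velocity unbounded at infinity: not Sideris data, cf. (1.2).) [folklore] -/
theorem expandingFlow_isSolution (A γ ρbar Sbar : ℝ) (hρ : 0 < ρbar) :
    IsPolytropicC1Solution A γ (Ici 0) (expandDensity ρbar) expandVelocity (expandEntropy Sbar) where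
  contDiffOn_density := by
    have h1 : ContDiffOn ℝ 1 (fun p : ℝ × E3 => (1 + p.1) ^ 3) (Ici (0:ℝ) ×ˢ (univ : Set E3)) :=
      (contDiffOn_const.add contDiffOn_fst).pow 3
    have h2 : ∀ p ∈ Ici (0:ℝ) ×ˢ (univ : Set E3), (1 + p.1) ^ 3 ≠ 0 := by
      rintro ⟨t, x⟩ ⟨ht, -⟩
      simp only [mem_Ici] at ht
      positivity
    simpa [expandDensity] using contDiffOn_const.mul (h1.inv h2)
  contDiffOn_velocity := by
    have h1 : ContDiffOn ℝ 1 (fun p : ℝ × E3 => (1 + p.1)) (Ici (0:ℝ) ×ˢ (univ : Set E3)) :=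
      contDiffOn_const.add contDiffOn_fst
    have h2 : ∀ p ∈ Ici (0:ℝ) ×ˢ (univ : Set E3), (1 + p.1) ≠ 0 := by
      rintro ⟨t, x⟩ ⟨ht, -⟩
      simp only [mem_Ici] at ht
      positivity
    show ContDiffOn ℝ 1 (fun p : ℝ × E3 => (1 + p.1)⁻¹ • p.2) (Ici (0:ℝ) ×ˢ (univ : Set E3))
    exact (h1.inv h2).smul contDiffOn_snd
  contDiffOn_entropy := by
    simpa [expandEntropy] using contDiffOn_const
  density_pos := by
    intro t ht x
    simp only [mem_Ici] at ht
    simp only [expandDensity]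
    positivity
  mass := by
    intro t ht x
    simp only [mem_Ici] at ht
    have hd : HasDerivAt (fun s : ℝ => ρbar * ((1 + s) ^ 3)⁻¹)
        (ρbar * (-(3 * (1 + t) ^ 2 * 1) / ((1 + t) ^ 3) ^ 2)) t := by
      have h1 : HasDerivAt (fun s : ℝ => (1 + s) ^ 3) (((3 : ℕ) : ℝ) * (1 + t) ^ (3 - 1) * 1) t :=
        ((hasDerivAt_id t).const_add 1).fun_pow 3
      have h2 := (h1.inv (by positivity)).const_mul ρbar
      exact h2.congr_deriv (by norm_num)
    have hdw : timeDerivWithin (Ici 0) (expandDensity ρbar) t x =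
        ρbar * (-(3 * (1 + t) ^ 2 * 1) / ((1 + t) ^ 3) ^ 2) := by
      rw [timeDerivWithin_apply]
      exact hd.hasDerivWithinAt.derivWithin (uniqueDiffOn_Ici 0 t ht)
    have hdiv : divergence (fun y => expandDensity ρbar t y • expandVelocity t y) x =
        3 * (ρbar * ((1 + t) ^ 3)⁻¹ * (1 + t)⁻¹) := by
      have : (fun y => expandDensity ρbar t y • expandVelocity t y) =
          fun y : E3 => (ρbar * ((1 + t) ^ 3)⁻¹ * (1 + t)⁻¹) • y := by
        funext y
        simp only [expandDensity, expandVelocity, smul_smul]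
      rw [this, divergence_const_smul_id]
    have ht1 : (1 + t) ≠ 0 := by positivity
    rw [hdw, hdiv]
    field_simp
    ring
  momentum := by
    intro t ht x
    simp only [mem_Ici] at ht
    have ht1 : (1 + t) ≠ 0 := by positivity
    have hd : HasDerivAt (fun s : ℝ => (1 + s)⁻¹ • x) ((-(1:ℝ) / (1 + t) ^ 2) • x) t := by
      have h1 : HasDerivAt (fun s : ℝ => (1 + s)) 1 t := by
        simpa using ((hasDerivAt_id t).const_add 1)
      exact (h1.inv ht1).smul_const x
    have hdw : timeDerivWithin (Ici 0) expandVelocity t x = (-(1:ℝ) / (1 + t) ^ 2) • x := by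
      rw [timeDerivWithin_apply]
      exact hd.hasDerivWithinAt.derivWithin (uniqueDiffOn_Ici 0 t ht)
    have hconv : convect (expandVelocity t) (expandVelocity t) x =
        (1 + t)⁻¹ • ((1 + t)⁻¹ • x) := by
      have h : (expandVelocity t) = ⇑((1 + t)⁻¹ • ContinuousLinearMap.id ℝ E3) := by
        funext y; simp [expandVelocity]
      rw [convect_apply, h, ContinuousLinearMap.fderiv]
      simp
    have hgrad : gradient (fun y => polytropicPressure A γ (expandDensity ρbar t y)
        (expandEntropy Sbar t y)) x = 0 := by
      simp [expandDensity, expandEntropy, gradient]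
    rw [hdw, hconv, hgrad, smul_smul, ← add_smul]
    have : (-(1:ℝ) / (1 + t) ^ 2 + (1 + t)⁻¹ * (1 + t)⁻¹) = 0 := by
      field_simp
      ring
    rw [this, zero_smul, smul_zero, add_zero]
  entropy := by
    intro t ht x
    have h : expandEntropy Sbar t = fun _ : E3 => Sbar := rfl
    simp [timeDerivWithin_apply, expandEntropy, convect_apply, h]

/-! ### Clause (2): smooth Sideris large data exist -/

/-- A smooth bump on `ℝ³`: `= 1` on `closedBall 0 (R/2)`, supported in `ball 0 R`. [folklore] -/
def dataBump {R : ℝ} (hR : 0 < R) : ContDiffBump (0 : E3) :=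
  ⟨R / 2, R, by positivity, by linarith⟩

/-- The smooth outgoing velocity field `u₀(x) = (λ φ(x)) x` of Sideris' example after Theorem 1
(`ρ⁰ ≡ ρ̄`, `S⁰ ≡ S̄`, "the initial flow velocity must be supersonic in some region").
[cite: Sideris1985, §1 p. 477 (example after Theorem 1)] -/
def outgoingVelocity {R : ℝ} (hR : 0 < R) (lam : ℝ) (x : E3) : E3 :=
  (lam * dataBump hR x) • x

/-- `∑ᵢ xᵢ² = ‖x‖²` on `ℝ³`. [folklore] -/
theorem sum_mul_self_eq_norm_sq (x : E3) : ∑ i, x i * x i = ‖x‖ ^ 2 := by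
  rw [sum_mul_apply_eq_inner, real_inner_self_eq_norm_sq]

/-- `u₀` is smooth. [folklore] -/
theorem outgoingVelocity_contDiff {R : ℝ} (hR : 0 < R) (lam : ℝ) :
    ContDiff ℝ ∞ (outgoingVelocity hR lam) := by
  unfold outgoingVelocity
  exact (contDiff_const.mul (dataBump hR).contDiff).smul contDiff_id

/-- `u₀ = 0` for `‖x‖ ≥ R` ((1.2b)). [cite: Sideris1985, (1.2b)] -/
theorem outgoingVelocity_eq_zero {R : ℝ} (hR : 0 < R) (lam : ℝ) {x : E3} (hx : R ≤ ‖x‖) :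
    outgoingVelocity hR lam x = 0 := by
  unfold outgoingVelocity
  have : dataBump hR x = 0 := by
    apply ContDiffBump.zero_of_le_dist
    simpa [dataBump] using hx
  simp [this]

/-- The integrand of (1.5c) for these data: `ρ̄ x·u₀(x) = φ(x) · ρ̄ λ ‖x‖²`. [cite: Sideris1985, (1.5c)] -/
theorem outgoing_integrand_eq {R : ℝ} (hR : 0 < R) (lam ρbar : ℝ) (x : E3) :
    ρbar * ∑ i, x i * outgoingVelocity hR lam x i = dataBump hR x * (ρbar * lam * ‖x‖ ^ 2) := by
  have : ∀ i, x i * outgoingVelocity hR lam x i = (lam * dataBump hR x) * (x i * x i) := by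
    intro i
    simp only [outgoingVelocity, PiLp.smul_apply, smul_eq_mul]
    ring
  simp_rw [this, ← Finset.mul_sum, sum_mul_self_eq_norm_sq]
  ring

/-- Lower bound `F(0) ≥ vol(R/4 < |x| ≤ R/2) · ρ̄ λ (R/4)²` for the radial momentum of the data
(`φ = 1` and `‖x‖ > R/4` on the shell, integrand `≥ 0` elsewhere). [cite: Sideris1985, (1.5c)] -/
theorem radial_integral_ge {R : ℝ} (hR : 0 < R) {lam ρbar : ℝ} (hlam : 0 ≤ lam) (hρ : 0 ≤ ρbar) :
    (volume : Measure E3).real (closedBall (0 : E3) (R / 2) \ closedBall 0 (R / 4)) *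
        (ρbar * lam * (R / 4) ^ 2) ≤
      ∫ x, ρbar * ∑ i, x i * outgoingVelocity hR lam x i := by
  simp_rw [outgoing_integrand_eq]
  set S : Set E3 := closedBall (0 : E3) (R / 2) \ closedBall 0 (R / 4) with hS
  have hSm : MeasurableSet S := measurableSet_closedBall.diff measurableSet_closedBall
  have hSfin : (volume : Measure E3) S ≠ ⊤ :=
    ((measure_mono sdiff_subset).trans_lt measure_closedBall_lt_top).ne
  set c : ℝ := ρbar * lam * (R / 4) ^ 2 with hc
  have hg : Integrable (S.indicator fun _ => c) (volume : Measure E3) :=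
    (integrable_indicator_iff hSm).2 (integrableOn_const hSfin)
  have hφc : Continuous fun x : E3 => dataBump hR x := (dataBump hR).continuous
  have hf : Integrable (fun x : E3 => dataBump hR x * (ρbar * lam * ‖x‖ ^ 2))
      (volume : Measure E3) := by
    apply Continuous.integrable_of_hasCompactSupport
    · exact hφc.mul (continuous_const.mul (continuous_norm.pow 2))
    · exact (dataBump hR).hasCompactSupport.mul_right
  have hle : (S.indicator fun _ => c) ≤ fun x : E3 => dataBump hR x * (ρbar * lam * ‖x‖ ^ 2) := by
    intro x
    by_cases hx : x ∈ S
    · rw [indicator_of_mem hx]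
      show c ≤ dataBump hR x * (ρbar * lam * ‖x‖ ^ 2)
      have hx1 : x ∈ closedBall (0 : E3) (R / 2) := hx.1
      have hx2 : R / 4 < ‖x‖ := by
        have := hx.2
        simp only [mem_closedBall, dist_zero_right, not_le] at this
        exact this
      have hφ1 : dataBump hR x = 1 := by
        apply ContDiffBump.one_of_mem_closedBall
        simpa [dataBump] using hx1
      rw [hφ1, one_mul, hc]
      have : (R / 4) ^ 2 ≤ ‖x‖ ^ 2 := pow_le_pow_left₀ (by positivity) hx2.le 2
      exact mul_le_mul_of_nonneg_left this (by positivity)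
    · rw [indicator_of_notMem hx]
      show (0:ℝ) ≤ dataBump hR x * (ρbar * lam * ‖x‖ ^ 2)
      exact mul_nonneg (dataBump hR).nonneg (by positivity)
  have := integral_mono hg hf hle
  rwa [integral_indicator_const _ hSm, smul_eq_mul] at this

/-- `vol(R/4 < |x| ≤ R/2) = (4π/3)((R/2)³ − (R/4)³)`. [folklore] -/
theorem volume_real_shell {R : ℝ} (hR : 0 < R) :
    (volume : Measure E3).real (closedBall (0 : E3) (R / 2) \ closedBall 0 (R / 4)) =
      4 * Real.pi / 3 * (R / 2) ^ 3 - 4 * Real.pi / 3 * (R / 4) ^ 3 := by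
  rw [measureReal_sdiff (closedBall_subset_closedBall (by linarith)) measurableSet_closedBall
    measure_closedBall_lt_top.ne,
    volume_real_closedBall_fin_three 0 (by positivity), volume_real_closedBall_fin_three 0 (by positivity)]

/-- **Smooth Sideris large data exist** for every `R > 0`, `ρ̄ > 0` (and all `A, γ, S̄`):
`ρ₀ ≡ ρ̄`, `S₀ ≡ S̄` (so `m(0) = η(0) = 0`, (1.5 a–b)), `u₀ = λφ(x)x` smooth, vanishing for
`‖x‖ ≥ R` ((1.2)), with `λ` so large that `∫ x·ρ₀u₀ > (16π/3) σ R⁴ ρ̄ = (16π/3) σ R⁴ max ρ₀`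
((1.5c)) — Sideris' example after Theorem 1. Hence the kernel `ShockFormationBarrier` quantifies
over a non-empty class of smooth data. [cite: Sideris1985, §1 p. 477 (example after Theorem 1)] -/
theorem exists_smooth_siderisLargeData (A γ R ρbar Sbar : ℝ) (hR : 0 < R) (hρ : 0 < ρbar) :
    ∃ u₀ : E3 → E3, ContDiff ℝ ∞ u₀ ∧
      IsSiderisLargeData A γ R ρbar Sbar (fun _ => ρbar) u₀ (fun _ => Sbar) := by
  set V : ℝ := (volume : Measure E3).real (closedBall (0 : E3) (R / 2) \ closedBall 0 (R / 4))
    with hV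
  have hV0 : 0 < V := by
    rw [hV, volume_real_shell hR]
    have : 4 * Real.pi / 3 * (R / 2) ^ 3 - 4 * Real.pi / 3 * (R / 4) ^ 3 =
        4 * Real.pi / 3 * R ^ 3 * (7 / 64) := by ring
    rw [this]
    positivity
  set K : ℝ := 16 * Real.pi / 3 * farFieldSoundSpeed A γ ρbar Sbar * R ^ 4 * ρbar with hK
  set lam : ℝ := (|K| + 1) / (V * ρbar * (R / 4) ^ 2) with hlam
  have hden : 0 < V * ρbar * (R / 4) ^ 2 := by positivity
  have hlam0 : 0 ≤ lam := by rw [hlam]; positivity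
  refine ⟨outgoingVelocity hR lam, outgoingVelocity_contDiff hR lam, ?_⟩
  refine ⟨fun _ => hρ, fun x hx => ⟨rfl, outgoingVelocity_eq_zero hR lam hx, rfl⟩, by simp,
    by simp, ?_⟩
  have hsup : (⨆ _ : E3, ρbar) = ρbar := ciSup_const
  rw [hsup]
  refine lt_of_lt_of_le ?_ (radial_integral_ge hR hlam0 hρ.le)
  rw [← hV, ← hK]
  have : V * (ρbar * lam * (R / 4) ^ 2) = |K| + 1 := by
    rw [hlam]
    field_simp
  rw [this]
  exact (le_abs_self K).trans_lt (lt_add_one _)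

end PolytropicEuler

open PolytropicEuler

/-- **Narrowed barrier (audit 2026-08-15 of `ShockFormationBarrier`): only the CLASSICAL
relative entropy / weak–strong argument — entropy relative to an UNSHIFTED Lipschitz reference
solution — stops at the first shock; finite life span is a property of the data class; and the
weighted, shifted relative entropy (a-contraction) passes one-dimensional shocks at the PDE,
viscous and (2026 preprint) hard-sphere-Boltzmann level.**

Formal kernel (this `Prop`, proved in `shockFormationBarrierNarrow_holds`): (1) the parent kernel
`ShockFormationBarrier` (Sideris 1985, Thm 1); (2) for every `R > 0`, `ρ̄ > 0` (all `A, γ, S̄`)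
there are SMOOTH data `(ρ̄, u₀, S̄)` satisfying `IsSiderisLargeData` — the class in (1) is not
empty; (3) for every `ρ̄ > 0` (all `A, γ, S̄`) there is a GLOBAL `C¹` solution on `[0, ∞) × ℝ³`
of the same system with `ρ(0) ≡ ρ̄`, `S(0) ≡ S̄` and the non-trivial velocity `u(0) = id`
(homologous expansion) — the life span is finite only under hypotheses on the data such as (1.2),
(1.5c). [cite: Sideris1985, Theorem 1 and §1 p. 477]

BARRIER (D-0021), AtomisticToContinuum/HydrodynamicLimit:
technique_class: classical-relative-entropy yau-relative-entropy unshifted-lipschitz-reference-state lipschitz-weak-strong-uniqueness relative-energy-vs-strong-solution (the sub-family of the parent's `relative-entropy entropy-method weak-strong-uniqueness relative-energy` in which the entropy or energy is taken relative to the local Gibbs state / local Maxwellian / state vector of an UNSHIFTED, UNWEIGHTED Lipschitz (classical) solution: Yau 1991, Olla–Varadhan–Yau 1993, Kipnis–Landim Ch. 6, Dafermos–DiPerna weak–strong uniqueness, Březina–Feireisl measure-valued–strong uniqueness)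
technique_class_note: audit 2026-08-15 — the parent's four tokens are too broad: the printed sources restrict only the classical sub-family ("the relative entropy method requires the existence of a smooth solution" [cite: KipnisLandim1999, Ch. 6 p. 116]; "Our derivation is valid only in the smooth regime of the Euler equations" [cite: OllaVaradhanYau1993, §1 p. 525]; "Up to now, this method works as long as the limit solution is Lipschitz. It would be of significant interest to extend the method to shocks" [cite: LegerVasseur2011, §1 p. 4]), whereas the weighted relative entropy up to a dynamical shift (a-contraction) has since passed entropy shocks in one space dimension [cite: LegerVasseur2011, Abstract] [cite: KangVasseur2020, Abstract, Thm 1.1 and Remark 1.1 (2)] [cite: ChenKrupaVasseur2022, Abstract, Thm 1.3 and Thm 1.4], including — preprint — the hard-sphere Boltzmann-to-Euler limit toward Riemann solutions with shocks, arXiv:2605.24392 Abstract, §1 pp. 4–6, Thm 1.1 [claim: ChoeKangKim2026, status: under-review]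
blocks: ONLY (a) post-shock (beyond the classical existence time) strengthenings of `HydrodynamicLimit` argued with an UNSHIFTED Lipschitz Euler solution as reference state — Yau/Olla–Varadhan–Yau relative entropy `H(μ^N_t | ν^N_{λ(t,·)})` with smooth `λ` [cite: KipnisLandim1999, Ch. 6 §1 and Remark 1.13] [cite: OllaVaradhanYau1993, §1 p. 525 and Thm 2.1], Lipschitz weak–strong or measure-valued–strong uniqueness [cite: BrezinaFeireisl2018, Thm 3.3] — and only for data whose classical solution actually breaks down: Sideris large data (kernel (1)) [cite: Sideris1985, Theorem 1], compressed-and-outgoing data [cite: Sideris1985, Theorem 3], open sets near plane-symmetric simple waves for every smooth non-Chaplygin equation of state `p = p(ρ, s)` on `ℝ × 𝕋²` [cite: LukSpeck2024, Abstract and §1]; (b) in three dimensions WITHOUT planar symmetry, in addition, every argument whose target is "the admissible weak solution" after the first shock, for lack of uniqueness — this is `WildSolutionsBarrier` [cite: Markfelder2021, Thm 8.2.1], a target obstruction, not a relative-entropy one. NOT blocked: (A) one-dimensional or plane-symmetric post-shock limits by relative entropy WITH a-contraction weights and dynamically modulated shifts against (the local equilibrium of) an entropy shock or a Riemann solution —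 Navier–Stokes → Euler entropy shocks among all vanishing-viscosity limits [cite: KangVasseur2020, Thm 1.1 and Remark 1.1 (2)], hard-sphere Boltzmann → Euler Riemann solutions (two shocks and a contact, or rarefaction, contact and shock; small strength, well-prepared data, `L²([0,T] × ℝ × ℝ³)` convergence for every `T`, shock positions as BV shifts), arXiv:2605.24392 Thm 1.1 [claim: ChoeKangKim2026, status: under-review] — no implementation for interacting particle systems or Hamiltonian dynamics with noise (Yau's setting) is published; (B) data with NO first shock, where the classical method is already global: rest states, the homologous expansion of kernel (3) [folklore], global classical Euler solutions with expansive data (Serre, Grassin–Serre) [cite: Dafermos2005, §7.9 Notes], and on `𝕋` (planar data on `𝕋³`) the smooth space- and time-periodic shock-free pure tones of the `3 × 3` system about a generic non-constant entropy profile, for a general constitutive law `v = v(p, s)`, `v_p < 0`, arXiv:2305.15623 Thms 1.3–1.4 and Cor. 1.6 [claim: TempleYoung2023, status: under-review] (isentropic or barotropic periodic non-constant data always break down [cite: Dafermos2005, §7.7 Thm 7.7.2]); (C) the parent's evasions (i)–(ii) (attractiveness; stochastic compensated compactness).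
because: (1) Sideris' Theorem 1, proved in the tree from the finite propagation speed Proposition, (2.1c), (2.2 a–c) and the Riccati inequality (2.3) (`ShockFormationBarrier_holds`) [cite: Sideris1985, Theorem 1 and §2 pp. 479–480]; (2) Sideris' example `ρ⁰ ≡ ρ̄`, `S⁰ ≡ S̄`, "(1.5c) holds if `∫ x·u⁰(x) dx > ασR⁴`" [cite: Sideris1985, §1 p. 477 (example after Theorem 1)], realised by `u₀ = λφ(x)x` with a smooth bump `φ` and `λ` large (`exists_smooth_siderisLargeData`); (3) `u = x/(1+t)`, `ρ = ρ̄(1+t)⁻³`, `S = S̄`: `∂ₜu + (u·∇)u = 0`, spatially constant pressure, `∂ₜρ + div(ρu) = -3ρ̄(1+t)⁻⁴ + 3ρ̄(1+t)⁻⁴ = 0` (`expandingFlow_isSolution`) [folklore]; the classical method controls `∂ₜH(μ^N_t | ν^N_{λ(t,·)})` by a Taylor expansion in the smooth parameters `λ(t, x)` [cite: KipnisLandim1999, Ch. 6 §1], and this — not relative entropy as such — is what fails at a shock: "The contraction holds up to a shift, and is measured by a weighted relative entropy" [cite: KangVasseur2020, §1 p. 3]; "The key idea of the a-contraction method combines the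 relative entropy method with suitable weight and shift ... the relative entropy method alone is sufficient to establish the stability of regular solutions other than shocks", arXiv:2605.24392 §1 p. 5 [claim: ChoeKangKim2026, status: under-review].
evasions_known: (i) attractive systems: coupling and Kružkov inequalities, entropy solution for all times [cite: Rezakhanlou1991] [cite: KipnisLandim1999, Ch. 8]; (ii) stochastic compensated compactness with mesoscopic viscosity, one conservation law and two-component (Leroux) lattice models [cite: Fritz2004, pp. 143–145] [cite: FritzToth2004]; (iii) a-contraction = relative entropy up to a shift with weights: `L²` stability up to a translation and uniqueness of extremal shocks and contacts of large amplitude among bounded entropy solutions with strong traces [cite: LegerVasseur2011, Abstract and §1 p. 2]; weak–`BV` uniqueness for `2 × 2` systems, "extends the classical weak-strong uniqueness results which allow comparison to a smooth solution" [cite: ChenKrupaVasseur2022, Abstract, Thm 1.3 and Thm 1.4]; entropy shocks of isentropic Euler unique and stable "among all vanishing viscosity limits of solutions to associated Navier–Stokes systems ... measured by the relative entropy with respect to an entropy shock" [cite: KangVasseur2020, Abstract, Thm 1.1 and Remark 1.1 (2)]; one-dimensional hard-sphere Boltzmann → Euler Riemann solutions with shocks by "a kinetic adaptation of the a-contraction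 method", arXiv:2605.24392 Abstract and Thm 1.1 [claim: ChoeKangKim2026, status: under-review]; earlier entropy-method uniqueness of shocked solutions — DiPerna 1979 (small shocks, `2 × 2`, `L^∞ ∩ BV`), Chen–Frid(–Li) (Riemann solutions of `3 × 3` Euler, large oscillation, locally `BV`) — as reported in [cite: LegerVasseur2011, §1 p. 2]; (iv) kinetic → Euler across shocks by matched Hilbert expansions / energy methods around Boltzmann shock profiles: non-interacting shocks (S.-H. Yu 2005, convergence away from the shock) and generic Riemann superpositions of shock, rarefaction and contact [cite: HuangEtAl2013, Abstract and §1]; (v) shock-free data as in (B) of `blocks`.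
scope_caveats: (a) kernel (1) is Sideris' polytropic ideal gas on `ℝ³` with data constant outside a ball; breakdown for general smooth non-Chaplygin `p(ρ, s)` near plane symmetry on `ℝ × 𝕋²` (hence formally for the conjunct's hard-sphere law `p = ρθZ(ρσ³)`) is [cite: LukSpeck2024, Abstract and §1], not formalised; on `𝕋³` no breakdown theorem for the conjunct's data class is formalised, and by (B) a first shock need not occur for non-constant entropy-stratified planar data — "up to the first shock" may mean "for all times" on a non-empty, non-trivial data class; (b) every post-shock evasion in (iii)–(iv) is ONE-dimensional (or planar), for small wave strengths, and at the kinetic level for well-prepared data with the shock positions as dynamical unknowns (BV shifts); nothing is in print for interacting particle systems, for Hamiltonian dynamics with noise, or for non-planar shocks in `d = 3`, where (b) of `blocks` (`WildSolutionsBarrier`) takes over; (c) "relative entropy method", "a-contraction", "weak–strong uniqueness" are prose, not Lean definitions — the Prop types the PDE facts (1)–(3) only; (d) the conjunct `HydrodynamicLimit` is stated up to the first shock and is untouched by parent and narrowing alike.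
status: established-narrowed (kernel (1): theorem in print, Sideris 1985 Thm 1, proved in the tree; (2)–(3): proved here; restriction of the classical sub-family: documented [cite: KipnisLandim1999, Ch. 6 pp. 115–116] [cite: OllaVaradhanYau1993, §1 p. 525] [cite: LegerVasseur2011, §1 p. 4]; evasion by a-contraction: theorems in print (Leger–Vasseur 2011, Kang–Vasseur 2020/21, Chen–Krupa–Vasseur 2022) and a May 2026 preprint (Choe–Kang–Kim); shock-free periodic data: 2023 preprint (Temple–Young))
[cite: Sideris1985, Theorem 1 and §1 p. 477] -/
def ShockFormationBarrierNarrow : Prop :=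
  ShockFormationBarrier ∧
    (∀ (A γ R ρbar Sbar : ℝ), 0 < R → 0 < ρbar →
      ∃ u₀ : E3 → E3, ContDiff ℝ ∞ u₀ ∧
        IsSiderisLargeData A γ R ρbar Sbar (fun _ => ρbar) u₀ (fun _ => Sbar)) ∧
    ∀ (A γ ρbar Sbar : ℝ), 0 < ρbar →
      ∃ (ρ : ℝ → E3 → ℝ) (u : ℝ → E3 → E3) (S : ℝ → E3 → ℝ),
        IsPolytropicC1Solution A γ (Ici 0) ρ u S ∧ (ρ 0 = fun _ => ρbar) ∧
          (S 0 = fun _ => Sbar) ∧ u 0 = id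

/-- Discharge of the narrowed kernel: Sideris' Theorem 1 (`ShockFormationBarrier_holds`), the
smooth large data of `exists_smooth_siderisLargeData`, and the homologous expansion
`expandingFlow_isSolution`. [cite: Sideris1985, Theorem 1 and §1 p. 477] -/
theorem shockFormationBarrierNarrow_holds : ShockFormationBarrierNarrow := by
  refine ⟨ShockFormationBarrier_holds, fun A γ R ρbar Sbar hR hρ =>
    exists_smooth_siderisLargeData A γ R ρbar Sbar hR hρ, fun A γ ρbar Sbar hρ => ?_⟩
  refine ⟨expandDensity ρbar, expandVelocity, expandEntropy Sbar,
    expandingFlow_isSolution A γ ρbar Sbar hρ, ?_, rfl, expandVelocity_zero⟩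
  funext x
  simp [expandDensity]

/-- The parent kernel recovered from the narrowed entry. [cite: Sideris1985, Theorem 1] -/
theorem ShockFormationBarrierNarrow.parent (h : ShockFormationBarrierNarrow) :
    ShockFormationBarrier :=
  h.1

/-- Clause (3) in words: global-in-time `C¹` polytropic flows with non-trivial velocity exist, so
no statement of the form "every non-stationary classical compressible Euler flow on `ℝ³` breaks
down" holds — finite life span needs hypotheses on the data ((1.2), (1.5c) in kernel (1)). [folklore] -/
theorem exists_global_polytropicC1Solution (A γ ρbar Sbar : ℝ) (hρ : 0 < ρbar) :
    ∃ (ρ : ℝ → E3 → ℝ) (u : ℝ → E3 → E3) (S : ℝ → E3 → ℝ),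
      IsPolytropicC1Solution A γ (Ici 0) ρ u S ∧ u 0 ≠ fun _ => 0 := by
  refine ⟨expandDensity ρbar, expandVelocity, expandEntropy Sbar,
    expandingFlow_isSolution A γ ρbar Sbar hρ, ?_⟩
  intro h
  have h1 := congr_fun h (EuclideanSpace.single 0 1)
  have h2 := congr_arg (fun v : E3 => v 0) h1
  simp [expandVelocity] at h2

end Literature.Barriers.AtomisticToContinuum

end
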